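import Summits.HodgeConjecture.CorCM.IrreducibleOddWeightsRightIdealsPivotCMFields
import Literature.AlgebraicGeometry.Pohlmann1968.CMTypeRankInducedType
import HarnessLib

/-!
# Canonical pivot, III: INFLATION — the defect of a family of CM types is unchanged when every type is lifted to a
# bigger CM field; hence gen 64's exact Hecke formula on `L₀ ∩ L₁` holds for ANY two CM fields through their Galois
# closures

COR-CM (cell `pub-hodgecm2`, binder seat `b16` gen 65, count-neutral claim CANONICAL PIVOT, file C3 — CM fields;
theorems only, no definition, no named fact, no `sorry`).  NEW as stated, hence under `Summits/`.  HONEST FRAMING: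
unconditional statements about `dim MT` of products of abelian varieties with complex multiplication; `HC_CM` is neither
used nor asserted.

SETTING.  CM fields `K_i` with CM types `Φ_i`, embeddings `k_i : K_i → L_i` into bigger number fields, and the INDUCED
(lifted, inflated) types `Φ_i^{L_i} = {t̃ : L_i → ℂ | t̃ ∘ k_i ∈ Φ_i}` (tree `inducedCMType`; for `L_i` CM these are
the types of `A_i ⊗_{K_i} L_i ≃ A_i^{[L_i:K_i]}`).  The tree has `cmTypeRank (Φ^L) = cmTypeRank Φ` (Shimura §32.9
«`r(ξ) = r(Inf_{M/K}(ξ))`», `Pohlmann1968/CMTypeRankInducedType`) and `cmFamilyRank (Φ ∘ π) = cmFamilyRank Φ` for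
surjective slot maps (`Pohlmann1968/CMFamilyRankSlots`, «`Hg(∏ A_i^{k_i})` has the rank of `Hg(∏ A_i)`»).

* §1 **`cmFamilyRank_inducedCMType`** — INFLATION INVARIANCE OF THE FAMILY RANK:
  **`cmFamilyRank (Φ_i^{L_i})_i = cmFamilyRank (Φ_i)_i`** (`dim MT(∏_i A_i ⊗_{K_i} L_i) = dim MT(∏_i A_i)`): slotwise
  restriction `⊔_i Hom(L_i, ℂ) → ⊔_i Hom(K_i, ℂ)` is an `Aut(ℂ)`-equivariant surjection pulling `Σ(Φ)` back to
  `Σ(Φ^L)` (the tree's change-of-index lemma `typeRank_preimage_eq_of_surjective`).  With `cmTypeRank_inducedCMType`: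
  the DEFECT `Σ_i dim Hg(A_i) − dim Hg(∏ A_i)` and additivity are inflation invariants
  (`sum_cmTypeRank_inducedCMType`, `cmFamilyRank_add_card_eq_iff_inducedCMType`).
* §2 **`cmTypeRank_add_cmTypeRank_eq_cmFamilyRank_add_one_add_finrank_inf_of_inducedCMType`** — gen 64 R4's EXACT
  HECKE FORMULA `dim Hg(A₀) + dim Hg(A₁) − dim Hg(A₀ × A₁) = dim(w̃₀ℚ[Gal(M/ℚ)] ∩ w̃₁ℚ[Gal(M/ℚ)])` for ANY two CM fields
  `K₀`, `K₁`: the pivot `M` (Galois) need only embed in the BIGGER fields `L_κ ⊇ K_κ` (CM) and contain the intersection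
  of THEIR Galois closures, and the shadows `w̃_κ` are those of the INFLATED types,
  `w̃_κ(z) = Σ_{t̃ : L_κ → ℂ, t̃|_M = z} u_κ(t̃|_{K_κ})` (`sum_filter_antiVec_inducedCMType`).  THE CANONICAL INSTANCE:
  `L_κ` = a Galois closure of `K_κ` (CM by Streng I.2.2 (b), tree `isCMField_of_isNormalClosure`), `M ≅ L₀ ∩ L₁` — R4's
  hypothesis (GL) «the closures meet inside `z₀(M)`» then holds BY CONSTRUCTION
  (`…_of_inducedCMType_of_normal`: for normal `L_κ` with embeddings `ι_κ` it reads `ι₀(L₀) ∩ ι₁(L₁) ⊆ z₀(M)`).  So the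
  honest-open item «(GL) is sufficient, not necessary» of gen 64 is closed a second way (file C2 closes it by orbit sums
  over the trace `K₀ ∩ L₁` with no auxiliary field at all).

## References

* [Shimura1998] G. Shimura, *Abelian Varieties with Complex Multiplication and Modular Functions*, §32.7, §32.9 (proof:
  «`r(ξ) = r(Inf_{M/K}(ξ))`»), §8.1.
* [Dodson1987] B. Dodson, *On the Mumford–Tate group of an abelian variety with complex multiplication*, J. Algebra 111
  (1987), §1.1 (p. 50: the lift of a type).
* [Gordon1999HodgeAVSurvey] B. B. Gordon, *A survey of the Hodge conjecture for abelian varieties*, §3 Theorem (proof),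
  7.4–7.7, 9.4.3.
* [Kubota1965] T. Kubota, *On the field extension by complex multiplication*, Trans. AMS 118 (1965), §4 Lemma 2 (p. 119).
* [Lang2002] S. Lang, *Algebra*, VI §1 Thm. 1.14, V §3 Thm. 3.3.
-/

set_option autoImplicit false

noncomputable section

open scoped BigOperators Classical

open NumberField Module IntermediateField

namespace Summit.HodgeConjecture.CorCM

open Literature.NumberTheory.ComplexMultiplication
open Literature.AlgebraicGeometry.Motives (CMType)
open Literature.AlgebraicGeometry.Pohlmann1968

/-! ### §1 Inflation invariance of the family rank -/

section Inflation

variable {I : Type} {K L : I → Type} [∀ i, Field (K i)] [∀ i, NumberField (K i)] [∀ i, Field (L i)]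
  [∀ i, NumberField (L i)]

omit [∀ i, NumberField (K i)] [∀ i, NumberField (L i)] in
/-- `Σ(Φ^L)` is the preimage of `Σ(Φ)` under slotwise restriction `(i, t̃) ↦ (i, t̃ ∘ k_i)` (definitional).
[cite: Dodson1987, §1.1 (p. 50)] -/
theorem familyType_inducedCMType (k : ∀ i, K i →+* L i) (Φ : ∀ i, CMType (K i)) :
    CMAlgebra.familyType (fun i => inducedCMType (k i) (Φ i)) =
      (fun x : (i : I) × (L i →+* ℂ) => (⟨x.1, x.2.comp (k x.1)⟩ : (i : I) × (K i →+* ℂ))) ⁻¹'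
        CMAlgebra.familyType Φ :=
  rfl

omit [∀ i, NumberField (K i)] [∀ i, NumberField (L i)] in
/-- Slotwise restriction is `Aut(ℂ)`-equivariant. [cite: Shimura1998, §8.1] -/
theorem restrictSlots_smul (k : ∀ i, K i →+* L i) (τ : ℂ ≃+* ℂ) (x : (i : I) × (L i →+* ℂ)) :
    (fun x : (i : I) × (L i →+* ℂ) => (⟨x.1, x.2.comp (k x.1)⟩ : (i : I) × (K i →+* ℂ))) (τ • x) =
      τ • (fun x : (i : I) × (L i →+* ℂ) => (⟨x.1, x.2.comp (k x.1)⟩ : (i : I) × (K i →+* ℂ))) x := by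
  obtain ⟨i, t⟩ := x
  rfl

/-- Slotwise restriction is surjective (every embedding of `K_i` extends to `L_i ⊇ K_i`). [cite: Lang2002, V §2 Thm. 2.8] -/
theorem restrictSlots_surjective (k : ∀ i, K i →+* L i) :
    Function.Surjective
      (fun x : (i : I) × (L i →+* ℂ) => (⟨x.1, x.2.comp (k x.1)⟩ : (i : I) × (K i →+* ℂ))) := by
  rintro ⟨i, s⟩
  obtain ⟨t, ht⟩ := comp_surjective (k i) s
  exact ⟨⟨i, t⟩, by rw [Sigma.mk.inj_iff]; exact ⟨rfl, heq_of_eq ht⟩⟩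

/-- **INFLATION INVARIANCE: `cmFamilyRank (Φ_i^{L_i})_i = cmFamilyRank (Φ_i)_i`** — lifting every type of a family to a
bigger field does not change the rank of the family (`dim MT(∏_i A_i ⊗_{K_i} L_i) = dim MT(∏_i A_i)`; Shimura's
«`r(ξ) = r(Inf(ξ))`» for CM algebras). [cite: Shimura1998, §32.9 (proof) and §32.7] [cite: Gordon1999HodgeAVSurvey, 7.6.1] -/
theorem cmFamilyRank_inducedCMType (k : ∀ i, K i →+* L i) (Φ : ∀ i, CMType (K i)) :
    CMAlgebra.cmFamilyRank (fun i => inducedCMType (k i) (Φ i)) = CMAlgebra.cmFamilyRank Φ := by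
  unfold CMAlgebra.cmFamilyRank
  rw [familyType_inducedCMType]
  exact typeRank_preimage_eq_of_surjective _ _ (restrictSlots_smul k) (restrictSlots_surjective k)

omit [∀ i, NumberField (K i)] in
/-- `Σ_i cmTypeRank (Φ_i^{L_i}) = Σ_i cmTypeRank Φ_i` (the tree's `cmTypeRank_inducedCMType` slot by slot).
[cite: Shimura1998, §32.9 (proof)] -/
theorem sum_cmTypeRank_inducedCMType [Fintype I] (k : ∀ i, K i →+* L i) (Φ : ∀ i, CMType (K i)) :
    ∑ i, cmTypeRank (inducedCMType (k i) (Φ i)) = ∑ i, cmTypeRank (Φ i) :=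
  Finset.sum_congr rfl fun i _ => cmTypeRank_inducedCMType (k i) (Φ i)

/-- **The DEFECT is an inflation invariant**: `Σ_i cmTypeRank Φ_i + 1 − cmFamilyRank Φ − |I|` is the same for `(Φ_i)` and
`(Φ_i^{L_i})` — stated without subtraction. [cite: Shimura1998, §32.9 (proof)] [cite: Gordon1999HodgeAVSurvey, 7.6.1] -/
theorem sum_cmTypeRank_add_cmFamilyRank_inducedCMType [Fintype I] (k : ∀ i, K i →+* L i) (Φ : ∀ i, CMType (K i)) :
    (∑ i, cmTypeRank (inducedCMType (k i) (Φ i))) + CMAlgebra.cmFamilyRank Φ =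
      (∑ i, cmTypeRank (Φ i)) + CMAlgebra.cmFamilyRank (fun i => inducedCMType (k i) (Φ i)) := by
  rw [sum_cmTypeRank_inducedCMType, cmFamilyRank_inducedCMType]

/-- **Additivity is an inflation invariant**: `Hg(∏ A_i) = ∏ Hg(A_i)` iff the same holds after lifting every type.
[cite: Gordon1999HodgeAVSurvey, 7.6.1 and 7.7] -/
theorem cmFamilyRank_add_card_eq_iff_inducedCMType [Fintype I] (k : ∀ i, K i →+* L i) (Φ : ∀ i, CMType (K i)) :
    CMAlgebra.cmFamilyRank Φ + Fintype.card I = (∑ i, cmTypeRank (Φ i)) + 1 ↔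
      CMAlgebra.cmFamilyRank (fun i => inducedCMType (k i) (Φ i)) + Fintype.card I =
        (∑ i, cmTypeRank (inducedCMType (k i) (Φ i))) + 1 := by
  rw [sum_cmTypeRank_inducedCMType, cmFamilyRank_inducedCMType]

omit [∀ i, NumberField (K i)] [∀ i, NumberField (L i)] in
/-- The type vector of the inflated type is the pull-back of the type vector: `u(Φ^L)(g; t̃) = u(Φ)(g; t̃ ∘ k)`.
[cite: Dodson1987, §1.1 (p. 50)] -/
theorem antiVec_inducedCMType {i : I} (k : K i →+* L i) (Φ : CMType (K i)) (g : ℂ ≃+* ℂ) (t : L i →+* ℂ) :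
    antiVec (inducedCMType k Φ).1 g t = antiVec Φ.1 g (t.comp k) := by
  simp only [antiVec, translateInd]
  rfl

omit [∀ i, NumberField (K i)] in
/-- **The shadow of the inflated type**: `Σ_{t̃ : L → ℂ, t̃ ∘ j = z} u(Φ^L)(t̃) = Σ_{t̃ ∘ j = z} u(Φ)(t̃ ∘ k)` — on `M ↪ L`
the inflated type casts the shadow "number of extensions to `L` over `z` whose restriction to `K` lies in `Φ`, signed".
[cite: Kubota1965, §4 Lemma 2 (p. 119)] [cite: Shimura1998, §32.9] -/
theorem sum_filter_antiVec_inducedCMType {i : I} {M : Type} [Field M] (k : K i →+* L i) (j : M →+* L i)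
    (Φ : CMType (K i)) (g : ℂ ≃+* ℂ) (z : M →+* ℂ) :
    ∑ t ∈ Finset.univ.filter (fun t : L i →+* ℂ => t.comp j = z), antiVec (inducedCMType k Φ).1 g t =
      ∑ t ∈ Finset.univ.filter (fun t : L i →+* ℂ => t.comp j = z), antiVec Φ.1 g (t.comp k) :=
  Finset.sum_congr rfl fun t _ => antiVec_inducedCMType k Φ g t

end Inflation

/-! ### §2 The exact Hecke formula on `L₀ ∩ L₁` for any two CM fields, through the Galois closures -/

section Hecke

variable {I : Type} [Fintype I] {K L : I → Type} [∀ i, Field (K i)] [∀ i, NumberField (K i)]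
  [∀ i, Field (L i)] [∀ i, NumberField (L i)] [∀ i, IsCMField (L i)] {M : Type} [Field M] [NumberField M]

/-- **THE EXACT HECKE FORMULA FOR ANY TWO CM FIELDS, THROUGH INFLATION.**  `K_κ ↪ L_κ` (CM), `M` Galois with
`j_κ : M → L_κ`, `z₀ : M → ℂ` such that the Galois closures of the BIGGER fields `L_{i₀}`, `L_{i₁}` meet inside `z₀(M)`.
Then **`cmTypeRank Φ₀ + cmTypeRank Φ₁ = cmFamilyRank Φ + 1 + dim(H̃₀ ∩ H̃₁)`**, i.e.
**`dim Hg(A₀) + dim Hg(A₁) − dim Hg(A₀ × A₁) = dim(w̃₀ℚ[Gal(M/ℚ)] ∩ w̃₁ℚ[Gal(M/ℚ)])`**, with the shadows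
`w̃_κ(z) = Σ_{t̃ : L_κ → ℂ, t̃ ∘ j_κ = z} u_κ(t̃ ∘ k_κ)` of the INFLATED types and their Hecke translates `w̃_κ(· ∘ δ)` —
gen 64 R4 applied to `(Φ_κ^{L_κ})`, whose ranks and family rank are those of `(Φ_κ)` (§1); only the `L_κ` need be
CM.  CANONICAL INSTANCE:
`L_κ` a Galois closure of `K_κ`, `M ≅ L₀ ∩ L₁`: NO hypothesis on `K₀`, `K₁` remains.
[cite: Kubota1965, §4 Lemma 2 (p. 119)] [cite: Gordon1999HodgeAVSurvey, §3 Theorem (proof), 7.5–7.7 and 9.4.3]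
[cite: Shimura1998, §32.9 (proof)] [cite: Lang2002, VI §1 Thm. 1.14] -/
theorem cmTypeRank_add_cmTypeRank_eq_cmFamilyRank_add_one_add_finrank_inf_of_inducedCMType [IsGalois ℚ M]
    {i₀ i₁ : I} (h01 : i₀ ≠ i₁) (hI : ∀ l, l = i₀ ∨ l = i₁) (Φ : ∀ i, CMType (K i)) (k : ∀ i, K i →+* L i)
    (j₀ : M →+* L i₀) (j₁ : M →+* L i₁) (z₀ : M →+* ℂ)
    (hmeet : ∀ z : ℂ, z ∈ normalClosure ℚ (L i₀) ℂ → z ∈ normalClosure ℚ (L i₁) ℂ → z ∈ Set.range z₀) :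
    cmTypeRank (Φ i₀) + cmTypeRank (Φ i₁) = CMAlgebra.cmFamilyRank Φ + 1 +
      Module.finrank ℚ (Submodule.span ℚ (Set.range fun δ : M ≃ₐ[ℚ] M => fun z : M →+* ℂ =>
            ∑ t ∈ Finset.univ.filter (fun t : L i₀ →+* ℂ => t.comp j₀ = z.comp (δ : M →+* M)),
              antiVec (Φ i₀).1 (1 : ℂ ≃+* ℂ) (t.comp (k i₀))) ⊓
          Submodule.span ℚ (Set.range fun δ : M ≃ₐ[ℚ] M => fun z : M →+* ℂ =>
            ∑ t ∈ Finset.univ.filter (fun t : L i₁ →+* ℂ => t.comp j₁ = z.comp (δ : M →+* M)),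
              antiVec (Φ i₁).1 (1 : ℂ ≃+* ℂ) (t.comp (k i₁))) : Submodule ℚ ((M →+* ℂ) → ℚ)) := by
  have h := cmTypeRank_add_cmTypeRank_eq_cmFamilyRank_add_one_add_finrank_inf h01 hI
    (fun i => inducedCMType (k i) (Φ i)) j₀ j₁ z₀ hmeet
  have e₀ : (fun δ : M ≃ₐ[ℚ] M => fun z : M →+* ℂ =>
      ∑ t ∈ Finset.univ.filter (fun t : L i₀ →+* ℂ => t.comp j₀ = z.comp (δ : M →+* M)),
        antiVec (inducedCMType (k i₀) (Φ i₀)).1 (1 : ℂ ≃+* ℂ) t) =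
      fun δ : M ≃ₐ[ℚ] M => fun z : M →+* ℂ =>
        ∑ t ∈ Finset.univ.filter (fun t : L i₀ →+* ℂ => t.comp j₀ = z.comp (δ : M →+* M)),
          antiVec (Φ i₀).1 (1 : ℂ ≃+* ℂ) (t.comp (k i₀)) := by
    funext δ z
    exact sum_filter_antiVec_inducedCMType (k i₀) j₀ (Φ i₀) 1 _
  have e₁ : (fun δ : M ≃ₐ[ℚ] M => fun z : M →+* ℂ =>
      ∑ t ∈ Finset.univ.filter (fun t : L i₁ →+* ℂ => t.comp j₁ = z.comp (δ : M →+* M)),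
        antiVec (inducedCMType (k i₁) (Φ i₁)).1 (1 : ℂ ≃+* ℂ) t) =
      fun δ : M ≃ₐ[ℚ] M => fun z : M →+* ℂ =>
        ∑ t ∈ Finset.univ.filter (fun t : L i₁ →+* ℂ => t.comp j₁ = z.comp (δ : M →+* M)),
          antiVec (Φ i₁).1 (1 : ℂ ≃+* ℂ) (t.comp (k i₁)) := by
    funext δ z
    exact sum_filter_antiVec_inducedCMType (k i₁) j₁ (Φ i₁) 1 _
  rw [cmTypeRank_inducedCMType, cmTypeRank_inducedCMType, cmFamilyRank_inducedCMType, e₀, e₁] at h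
  exact h

/-- **`Hg(A₀ × A₁) = Hg(A₀) × Hg(A₁)` iff `H̃₀ ∩ H̃₁ = 0`** (the inflated shadows' Hecke modules on `M` meet in `0`), same
hypotheses. [cite: Kubota1965, §4 Lemma 2 (p. 119)] [cite: Gordon1999HodgeAVSurvey, §3 Theorem and 7.5–7.7] -/
theorem cmFamilyRank_add_card_eq_pair_iff_finrank_inf_eq_zero_of_inducedCMType [IsGalois ℚ M] {i₀ i₁ : I}
    (h01 : i₀ ≠ i₁) (hI : ∀ l, l = i₀ ∨ l = i₁) (Φ : ∀ i, CMType (K i)) (k : ∀ i, K i →+* L i)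
    (j₀ : M →+* L i₀) (j₁ : M →+* L i₁) (z₀ : M →+* ℂ)
    (hmeet : ∀ z : ℂ, z ∈ normalClosure ℚ (L i₀) ℂ → z ∈ normalClosure ℚ (L i₁) ℂ → z ∈ Set.range z₀) :
    CMAlgebra.cmFamilyRank Φ + Fintype.card I = (∑ i, cmTypeRank (Φ i)) + 1 ↔
      Module.finrank ℚ (Submodule.span ℚ (Set.range fun δ : M ≃ₐ[ℚ] M => fun z : M →+* ℂ =>
            ∑ t ∈ Finset.univ.filter (fun t : L i₀ →+* ℂ => t.comp j₀ = z.comp (δ : M →+* M)),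
              antiVec (Φ i₀).1 (1 : ℂ ≃+* ℂ) (t.comp (k i₀))) ⊓
          Submodule.span ℚ (Set.range fun δ : M ≃ₐ[ℚ] M => fun z : M →+* ℂ =>
            ∑ t ∈ Finset.univ.filter (fun t : L i₁ →+* ℂ => t.comp j₁ = z.comp (δ : M →+* M)),
              antiVec (Φ i₁).1 (1 : ℂ ≃+* ℂ) (t.comp (k i₁))) : Submodule ℚ ((M →+* ℂ) → ℚ)) = 0 := by
  have hpair := cmTypeRank_add_cmTypeRank_eq_cmFamilyRank_add_one_add_finrank_inf_of_inducedCMType h01 hI Φ k j₀ j₁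
    z₀ hmeet
  have hcard : Fintype.card I = 2 := by
    rw [← Finset.card_univ, show (Finset.univ : Finset I) = {i₀, i₁} from Finset.ext fun j => by
      simpa only [Finset.mem_univ, Finset.mem_insert, Finset.mem_singleton, true_iff] using hI j,
      Finset.card_pair h01]
  rw [IrrOdd.sum_eq_add_of_pair _ hI h01, hcard]
  omega

omit [Fintype I] [∀ i, NumberField (K i)] [∀ i, IsCMField (L i)] [NumberField M] in
/-- For NORMAL `L` every element of its Galois closure in `ℂ` is a value of the chosen embedding `ι : L → ℂ`.
[cite: Lang2002, V §3 Thm. 3.3] -/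
theorem mem_range_of_mem_normalClosure_of_normal {i : I} [Normal ℚ (L i)] (ι : L i →+* ℂ) {z : ℂ}
    (hz : z ∈ normalClosure ℚ (L i) ℂ) : z ∈ Set.range ι := by
  have hle : normalClosure ℚ (L i) ℂ ≤ ι.toRatAlgHom.fieldRange := by
    rw [normalClosure_le_iff]
    intro f
    rintro _ ⟨y, rfl⟩
    obtain ⟨m, hm⟩ := apply_mem_range_of_normal ι (f : L i →+* ℂ) y
    exact ⟨m, hm⟩
  obtain ⟨m, hm⟩ := hle hz
  exact ⟨m, hm⟩

/-- **THE CANONICAL INSTANCE, normal containers**: if `L_{i₀}`, `L_{i₁}` are NORMAL over `ℚ` (e.g. Galois closures of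
`K_{i₀}`, `K_{i₁}`), R4's hypothesis is just `ι₀(L_{i₀}) ∩ ι₁(L_{i₁}) ⊆ z₀(M)` for any embeddings `ι_κ` — satisfied by
`M ≅ L₀ ∩ L₁`; the exact Hecke formula follows for every pair of CM fields.
[cite: Kubota1965, §4 Lemma 2 (p. 119)] [cite: Gordon1999HodgeAVSurvey, §3 Theorem and 7.5–7.7] [cite: Lang2002, VI §1 Thm. 1.14] -/
theorem cmTypeRank_add_cmTypeRank_eq_cmFamilyRank_add_one_add_finrank_inf_of_inducedCMType_of_normal
    [IsGalois ℚ M] {i₀ i₁ : I} [Normal ℚ (L i₀)] [Normal ℚ (L i₁)] (h01 : i₀ ≠ i₁) (hI : ∀ l, l = i₀ ∨ l = i₁)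
    (Φ : ∀ i, CMType (K i)) (k : ∀ i, K i →+* L i) (j₀ : M →+* L i₀) (j₁ : M →+* L i₁) (z₀ : M →+* ℂ)
    (ι₀ : L i₀ →+* ℂ) (ι₁ : L i₁ →+* ℂ) (hmeet : ∀ z : ℂ, z ∈ Set.range ι₀ → z ∈ Set.range ι₁ → z ∈ Set.range z₀) :
    cmTypeRank (Φ i₀) + cmTypeRank (Φ i₁) = CMAlgebra.cmFamilyRank Φ + 1 +
      Module.finrank ℚ (Submodule.span ℚ (Set.range fun δ : M ≃ₐ[ℚ] M => fun z : M →+* ℂ =>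
            ∑ t ∈ Finset.univ.filter (fun t : L i₀ →+* ℂ => t.comp j₀ = z.comp (δ : M →+* M)),
              antiVec (Φ i₀).1 (1 : ℂ ≃+* ℂ) (t.comp (k i₀))) ⊓
          Submodule.span ℚ (Set.range fun δ : M ≃ₐ[ℚ] M => fun z : M →+* ℂ =>
            ∑ t ∈ Finset.univ.filter (fun t : L i₁ →+* ℂ => t.comp j₁ = z.comp (δ : M →+* M)),
              antiVec (Φ i₁).1 (1 : ℂ ≃+* ℂ) (t.comp (k i₁))) : Submodule ℚ ((M →+* ℂ) → ℚ)) :=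
  cmTypeRank_add_cmTypeRank_eq_cmFamilyRank_add_one_add_finrank_inf_of_inducedCMType h01 hI Φ k j₀ j₁ z₀
    fun z h₀ h₁ => hmeet z (mem_range_of_mem_normalClosure_of_normal ι₀ h₀)
      (mem_range_of_mem_normalClosure_of_normal ι₁ h₁)

/-- **The unconditional half needs no pivot hypothesis**: for ANY Galois `M` received by the bigger fields,
`cmFamilyRank Φ + 1 + dim(H̃₀ ∩ H̃₁) ≤ cmTypeRank Φ₀ + cmTypeRank Φ₁` with the inflated shadows (R4's unconditional half
through §1) — common Hecke combinations of inflated shadows witness drops of `dim Hg(A₀ × A₁)`.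
[cite: Gordon1999HodgeAVSurvey, §3 Theorem (proof) and 7.5] [cite: Kubota1965, §4] -/
theorem cmFamilyRank_add_one_add_finrank_inf_le_of_inducedCMType [IsGalois ℚ M] {i₀ i₁ : I} (h01 : i₀ ≠ i₁)
    (hI : ∀ l, l = i₀ ∨ l = i₁) (Φ : ∀ i, CMType (K i)) (k : ∀ i, K i →+* L i) (j₀ : M →+* L i₀)
    (j₁ : M →+* L i₁) (z₀ : M →+* ℂ) :
    CMAlgebra.cmFamilyRank Φ + 1 +
        Module.finrank ℚ (Submodule.span ℚ (Set.range fun δ : M ≃ₐ[ℚ] M => fun z : M →+* ℂ =>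
            ∑ t ∈ Finset.univ.filter (fun t : L i₀ →+* ℂ => t.comp j₀ = z.comp (δ : M →+* M)),
              antiVec (Φ i₀).1 (1 : ℂ ≃+* ℂ) (t.comp (k i₀))) ⊓
          Submodule.span ℚ (Set.range fun δ : M ≃ₐ[ℚ] M => fun z : M →+* ℂ =>
            ∑ t ∈ Finset.univ.filter (fun t : L i₁ →+* ℂ => t.comp j₁ = z.comp (δ : M →+* M)),
              antiVec (Φ i₁).1 (1 : ℂ ≃+* ℂ) (t.comp (k i₁))) : Submodule ℚ ((M →+* ℂ) → ℚ)) ≤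
      cmTypeRank (Φ i₀) + cmTypeRank (Φ i₁) := by
  have h := cmFamilyRank_add_one_add_finrank_inf_le h01 hI (fun i => inducedCMType (k i) (Φ i)) j₀ j₁ z₀
  have e₀ : (fun δ : M ≃ₐ[ℚ] M => fun z : M →+* ℂ =>
      ∑ t ∈ Finset.univ.filter (fun t : L i₀ →+* ℂ => t.comp j₀ = z.comp (δ : M →+* M)),
        antiVec (inducedCMType (k i₀) (Φ i₀)).1 (1 : ℂ ≃+* ℂ) t) =
      fun δ : M ≃ₐ[ℚ] M => fun z : M →+* ℂ =>
        ∑ t ∈ Finset.univ.filter (fun t : L i₀ →+* ℂ => t.comp j₀ = z.comp (δ : M →+* M)),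
          antiVec (Φ i₀).1 (1 : ℂ ≃+* ℂ) (t.comp (k i₀)) := by
    funext δ z
    exact sum_filter_antiVec_inducedCMType (k i₀) j₀ (Φ i₀) 1 _
  have e₁ : (fun δ : M ≃ₐ[ℚ] M => fun z : M →+* ℂ =>
      ∑ t ∈ Finset.univ.filter (fun t : L i₁ →+* ℂ => t.comp j₁ = z.comp (δ : M →+* M)),
        antiVec (inducedCMType (k i₁) (Φ i₁)).1 (1 : ℂ ≃+* ℂ) t) =
      fun δ : M ≃ₐ[ℚ] M => fun z : M →+* ℂ =>
        ∑ t ∈ Finset.univ.filter (fun t : L i₁ →+* ℂ => t.comp j₁ = z.comp (δ : M →+* M)),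
          antiVec (Φ i₁).1 (1 : ℂ ≃+* ℂ) (t.comp (k i₁)) := by
    funext δ z
    exact sum_filter_antiVec_inducedCMType (k i₁) j₁ (Φ i₁) 1 _
  rw [cmTypeRank_inducedCMType, cmTypeRank_inducedCMType, cmFamilyRank_inducedCMType, e₀, e₁] at h
  exact h

end Hecke

end Summit.HodgeConjecture.CorCM

end
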